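import Literature.ModelTheory.PseudofiniteFields.EtaleOpenTopologyBasis
import Literature.ModelTheory.PseudofiniteFields.EtaleImageLine
import Literature.ModelTheory.PseudofiniteFields.PlaneCurvesPseudofinite
import HarnessLib

/-!
# Johnson–Tran–Walsberg–Ye, Theorem 7.1, for pseudo-finite fields (discharge of `JohnsonTranWalsbergYe2024_thm71_psf`)

Topic `Literature/ModelTheory/PseudofiniteFields`; proofs file for `EtaleOpenTopology.lean`.
Main results:

* `EtaleDatum.image_infinite_of_nonempty_psf` — over a pseudo-finite field `K`, a nonempty
  étale image in `𝔸¹(K)` is infinite;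
* `JohnsonTranWalsbergYe2024_thm71_psf_holds : JohnsonTranWalsbergYe2024_thm71_psf` — no point of
  a standard smooth locus `{g = 0, hΔ ≠ 0} ⊆ K^m` of codimension `c < m` is étale-isolated.

Printed proof [JohnsonTranWalsbergYe2024, Thm 7.1]: a pseudo-finite field is PAC (Ax 1968),
hence large (Pop 1996), and largeness is equivalent to the non-discreteness of the étale-open
topology at smooth points of positive-dimensional varieties.  The formal proof follows the same
line in coordinates:

1. *PAC for plane curves* (`PlaneCurvesPseudofinite.lean`): transfer of the Weil bound;
2. *non-discreteness of étale images of the line* (`EtaleImageLine.lean`): local structure of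
   étale algebras (Mathlib, Stacks 00UE) reduces an étale image near a point to the projection of
   a plane curve `{F = 0, g ≠ 0}` with `F` monic in the fibre variable and a non-singular point;
3. *reduction to the line* (this file, namespace `Thm71`): given `p ∈ S.locus` and an isolating
   étale datum `D` (`D.image ∩ S.locus ⊆ {p}`), pick a coordinate `i₀` not among the `c < m`
   distinguished columns and form the étale datum `lineDatum S D p i₀` over the line
   `s ↦ p + s e_{i₀}` with auxiliary variables `(x_cols, t)`, equations `(g, G)` and localisation
   `h·H`; its Jacobian is block triangular, `= Δ · J` after substitution
   (`jacobianDet_lineDatum`), and its image is exactly `{0}` — nonempty and finite, contradicting 2.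

Genuine definitions: `Thm71.lineMap`, `Thm71.lineDatum`, `Thm71.linePoint` (the combined datum
and the reconstruction of points).  No named facts; this file DISCHARGES
`JohnsonTranWalsbergYe2024_thm71_psf`.

## References

* W. Johnson, C.-M. Tran, E. Walsberg, J. Ye, *The étale-open topology and the stable fields
  conjecture*, J. Eur. Math. Soc. 26 (2024) 4033–4070, Thm 7.1, Thm A. [JohnsonTranWalsbergYe2024]
* F. Pop, *Embedding problems over large fields*, Ann. of Math. 144 (1996) 1–34, Prop. 1.1.
  [Pop1996]
* J. Ax, *The elementary theory of finite fields*, Ann. of Math. 88 (1968) 239–271, §§7–8. [Ax1968]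
-/

namespace Literature.ModelTheory.PseudofiniteFields

open MvPolynomial FirstOrder FirstOrder.Language FirstOrder.Ring

namespace EtaleDatum

variable {K : Type*} [CommRing K]

/-- **Chain rule for a substitution, two index types**: if `∂/∂z ∘ Φ` and `Φ ∘ ∂/∂y` agree on the
variables they agree everywhere (`Φ = aeval f`). [folklore] -/
theorem pderiv_aeval_eq_aeval_pderiv {σ τ : Type*} (f : σ → MvPolynomial τ K) (z : τ) (y : σ)
    (hf : ∀ s, pderiv z (f s) = aeval f (pderiv y (X s : MvPolynomial σ K)))
    (q : MvPolynomial σ K) : pderiv z (aeval f q) = aeval f (pderiv y q) := by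
  induction q using MvPolynomial.induction_on with
  | C a => simp
  | add p q hp hq => rw [map_add, map_add, map_add, map_add, hp, hq]
  | mul_X p s hp =>
    simp only [map_mul, Derivation.leibniz, smul_eq_mul, map_add, hp, aeval_X, hf]

end EtaleDatum

section Thm71

variable {K : Type*} [Field K] {m c r : ℕ}

/-- There is a coordinate outside the `c < m` distinguished columns (a local copy of
`SmoothDatum.exists_not_mem_range_cols` of `SmoothLocusDimension.lean`, not imported here).
[folklore] -/
private theorem SmoothDatum.exists_free_coord (hcm : c < m) (S : SmoothDatum K m c) :
    ∃ i₀ : Fin m, i₀ ∉ Set.range S.cols := by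
  by_contra h
  push Not at h
  have hsurj : Function.Surjective S.cols := fun i => h i
  have := Fintype.card_le_of_surjective _ hsurj
  simp only [Fintype.card_fin] at this
  omega

namespace Thm71

variable (S : SmoothDatum K m c) (D : EtaleDatum K m r) (p : Fin m → K) (i₀ : Fin m)

open Classical in
/-- The substitution of the line construction: `x_{i₀} ↦ p_{i₀} + s`, `x_{cols j} ↦ y_j`,
other `x_i ↦ p_i`, `t_k ↦ y_{c+k}`. [folklore] -/
noncomputable def lineMap : Fin m ⊕ Fin r → MvPolynomial (Fin 1 ⊕ Fin (c + r)) K :=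
  Sum.elim
    (fun i => if i = i₀ then C (p i₀) + X (Sum.inl 0)
      else if h : ∃ j, S.cols j = i then X (Sum.inr (Fin.castAdd r (Classical.choose h)))
      else C (p i))
    (fun k => X (Sum.inr (Fin.natAdd c k)))

/-- The combined étale datum over the line `p + s e_{i₀}`: equations `g(x) = 0` and
`G(x, t) = 0` in the auxiliary variables `(x_cols, t)`, localisation `h(x) H(x,t)`. [folklore] -/
noncomputable def lineDatum : EtaleDatum K 1 (c + r) where
  G := Fin.append (fun k => aeval (lineMap S p i₀) (rename Sum.inl (S.g k)))
    (fun k => aeval (lineMap S p i₀) (D.G k))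
  H := aeval (lineMap S p i₀) (rename Sum.inl S.h) * aeval (lineMap S p i₀) D.H

variable {S p i₀}

open Classical in
/-- The point of `K^m × K^r` reconstructed from a point `(s ; y)` of the line datum:
`x_{i₀} = p_{i₀} + s`, `x_{cols j} = y_j`, other `x_i = p_i`, `t_k = y_{c+k}`. [folklore] -/
noncomputable def linePoint (a : Fin 1 → K) (y : Fin (c + r) → K) : Fin m ⊕ Fin r → K :=
  Sum.elim
    (fun i => if i = i₀ then p i₀ + a 0
      else if h : ∃ j, S.cols j = i then y (Fin.castAdd r (Classical.choose h)) else p i)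
    (fun k => y (Fin.natAdd c k))

/-- Evaluating a substituted polynomial at `(s ; y)` is evaluating the original at the
reconstructed point. [folklore] -/
theorem eval_aeval_lineMap (a : Fin 1 → K) (y : Fin (c + r) → K) (q : MvPolynomial (Fin m ⊕ Fin r) K) :
    eval (Sum.elim a y) (aeval (lineMap S p i₀) q) = eval (linePoint (S := S) (p := p) (i₀ := i₀) a y) q := by
  classical
  induction q using MvPolynomial.induction_on with
  | C a => simp
  | add p q hp hq => rw [map_add, map_add, map_add, hp, hq]
  | mul_X q s hq =>
    rw [map_mul, map_mul, map_mul, hq, aeval_X, eval_X]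
    congr 1
    rcases s with i | k
    · simp only [lineMap, linePoint, Sum.elim_inl]
      split_ifs with h1 h2 <;> simp
    · simp [lineMap, linePoint]

variable (hi₀ : i₀ ∉ Set.range S.cols)
include hi₀

open Classical in
/-- Chain rule for the distinguished-column variables. [folklore] -/
theorem pderiv_castAdd_aeval_lineMap (j : Fin c) (q : MvPolynomial (Fin m ⊕ Fin r) K) :
    pderiv (Sum.inr (Fin.castAdd r j)) (aeval (lineMap S p i₀) q) =
      aeval (lineMap S p i₀) (pderiv (Sum.inl (S.cols j)) q) := by
  refine EtaleDatum.pderiv_aeval_eq_aeval_pderiv _ _ _ (fun s => ?_) q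
  rcases s with i | k
  · by_cases h0 : i = i₀
    · subst h0
      have hne : (Sum.inl i : Fin m ⊕ Fin r) ≠ Sum.inl (S.cols j) := fun h =>
        hi₀ ⟨j, (Sum.inl_injective h).symm⟩
      simp [lineMap, pderiv_X_of_ne hne, pderiv_X_of_ne (show (Sum.inl 0 : Fin 1 ⊕ Fin (c + r)) ≠
        Sum.inr (Fin.castAdd r j) from Sum.inl_ne_inr)]
    · by_cases h : ∃ j', S.cols j' = i
      · obtain ⟨j', rfl⟩ := h
        have hch : Classical.choose (⟨j', rfl⟩ : ∃ j'', S.cols j'' = S.cols j') = j' :=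
          S.cols.injective (Classical.choose_spec (⟨j', rfl⟩ : ∃ j'', S.cols j'' = S.cols j'))
        simp only [lineMap, Sum.elim_inl, if_neg h0, dif_pos (⟨j', rfl⟩ : ∃ j'', S.cols j'' = S.cols j'), hch]
        by_cases hjj : j' = j
        · subst hjj; simp
        · rw [pderiv_X_of_ne, pderiv_X_of_ne, map_zero]
          · exact fun h => hjj (S.cols.injective (Sum.inl_injective h))
          · exact fun h => hjj (Fin.castAdd_injective _ _ (Sum.inr_injective h))
      · have hne : (Sum.inl i : Fin m ⊕ Fin r) ≠ Sum.inl (S.cols j) := fun h' =>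
          h ⟨j, (Sum.inl_injective h').symm⟩
        simp [lineMap, h0, h, pderiv_X_of_ne hne]
  · have hne : (Sum.inr (Fin.natAdd c k) : Fin 1 ⊕ Fin (c + r)) ≠ Sum.inr (Fin.castAdd r j) := by
      intro h
      have := congrArg Fin.val (Sum.inr_injective h)
      simp at this
      omega
    simp [lineMap, pderiv_X_of_ne hne]

omit hi₀ in
open Classical in
/-- Chain rule for the auxiliary variables of `D`. [folklore] -/
theorem pderiv_natAdd_aeval_lineMap (k : Fin r) (q : MvPolynomial (Fin m ⊕ Fin r) K) :
    pderiv (Sum.inr (Fin.natAdd c k)) (aeval (lineMap S p i₀) q) =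
      aeval (lineMap S p i₀) (pderiv (Sum.inr k) q) := by
  refine EtaleDatum.pderiv_aeval_eq_aeval_pderiv _ _ _ (fun s => ?_) q
  rcases s with i | k'
  · have hne : (Sum.inl i : Fin m ⊕ Fin r) ≠ Sum.inr k := Sum.inl_ne_inr
    by_cases h0 : i = i₀
    · subst h0
      simp [lineMap, pderiv_X_of_ne (show (Sum.inl 0 : Fin 1 ⊕ Fin (c + r)) ≠
        Sum.inr (Fin.natAdd c k) from Sum.inl_ne_inr)]
    · by_cases h : ∃ j', S.cols j' = i
      · have hne' : (Sum.inr (Fin.castAdd r (Classical.choose h)) : Fin 1 ⊕ Fin (c + r)) ≠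
            Sum.inr (Fin.natAdd c k) := by
          intro h'
          have := congrArg Fin.val (Sum.inr_injective h')
          simp at this
          omega
        simp [lineMap, h0, h, pderiv_X_of_ne hne']
      · simp [lineMap, h0, h]
  · by_cases hkk : k' = k
    · subst hkk; simp [lineMap]
    · rw [lineMap, Sum.elim_inr, pderiv_X_of_ne, pderiv_X_of_ne, map_zero]
      · exact fun h => hkk (Sum.inr_injective h)
      · exact fun h => hkk (Fin.natAdd_injective _ _ (Sum.inr_injective h))

/-- **Block-triangular Jacobian of the line datum.** [folklore] -/
theorem jacobianDet_lineDatum :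
    (lineDatum S D p i₀).jacobianDet =
      aeval (lineMap S p i₀) (rename Sum.inl S.minor) * aeval (lineMap S p i₀) D.jacobianDet := by
  classical
  have hsub : (Matrix.of fun i j : Fin (c + r) => pderiv (Sum.inr j)
      ((lineDatum S D p i₀).G i)).submatrix finSumFinEquiv finSumFinEquiv =
      Matrix.fromBlocks
        ((Matrix.of fun i j : Fin c => pderiv (S.cols j) (S.g i)).map
          (fun q => aeval (lineMap S p i₀) (rename Sum.inl q)))
        0
        (Matrix.of fun i j => pderiv (Sum.inr (Fin.castAdd r j))
          (aeval (lineMap S p i₀) (D.G i)))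
        ((Matrix.of fun i j : Fin r => pderiv (Sum.inr j) (D.G i)).map
          (aeval (lineMap S p i₀))) := by
    refine Matrix.ext fun i j => ?_
    rcases i with i | i <;> rcases j with j | j
    · simp only [Matrix.submatrix_apply, finSumFinEquiv_apply_left, Matrix.of_apply, lineDatum,
        Fin.append_left, Matrix.fromBlocks_apply₁₁, Matrix.map_apply,
        pderiv_castAdd_aeval_lineMap hi₀, pderiv_rename Sum.inl_injective]
    · simp only [Matrix.submatrix_apply, finSumFinEquiv_apply_left, finSumFinEquiv_apply_right,
        Matrix.of_apply, lineDatum, Fin.append_left, Matrix.fromBlocks_apply₁₂, Matrix.zero_apply,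
        pderiv_natAdd_aeval_lineMap,
        EtaleDatum.pderiv_rename_eq_zero_of_forall_ne (fun s => Sum.inl_ne_inr), map_zero]
    · simp only [Matrix.submatrix_apply, finSumFinEquiv_apply_left, finSumFinEquiv_apply_right,
        Matrix.of_apply, lineDatum, Fin.append_right, Matrix.fromBlocks_apply₂₁]
    · simp only [Matrix.submatrix_apply, finSumFinEquiv_apply_right, Matrix.of_apply, lineDatum,
        Fin.append_right, Matrix.fromBlocks_apply₂₂, Matrix.map_apply,
        pderiv_natAdd_aeval_lineMap]
  rw [EtaleDatum.jacobianDet, ← Matrix.det_submatrix_equiv_self finSumFinEquiv, hsub,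
    Matrix.det_fromBlocks_zero₁₂, SmoothDatum.minor, EtaleDatum.jacobianDet, AlgHom.map_det,
    AlgHom.map_det, AlgHom.map_det, AlgHom.mapMatrix_apply, AlgHom.mapMatrix_apply,
    AlgHom.mapMatrix_apply, Matrix.map_map]
  rfl

/-- **Theorem 7.1 from the non-discreteness of étale images of the line.**  If every nonempty
étale image in `𝔸¹(K)` is infinite (`hPAC`), then no point `p` of a standard smooth locus
`S.locus` (`c < m`, witnessed by a free coordinate `i₀ ∉ cols`) is étale-isolated: an isolating
datum `D` and `S` combine into the étale datum `lineDatum S D p i₀` over the line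
`p + s·e_{i₀}` whose image is `{0}` — nonempty and finite. [cite: JohnsonTranWalsbergYe2024, Thm 7.1] -/
theorem not_isEtaleIsolatedIn_of_lines
    (hPAC : ∀ (r' : ℕ) (D' : EtaleDatum K 1 r'), D'.image.Nonempty → D'.image.Infinite)
    (hpS : p ∈ S.locus) (hpD : p ∈ D.image) (hiso : D.image ∩ S.locus ⊆ {p}) : False := by
  classical
  obtain ⟨hg, hh, hΔ⟩ := hpS
  obtain ⟨t₀, hG, hH, hJ⟩ := hpD
  set D'' := lineDatum S D p i₀ with hD''
  -- membership in the image of the line datum, unfolded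
  have hmem : ∀ (a : Fin 1 → K), a ∈ D''.image ↔ ∃ y : Fin (c + r) → K,
      (∀ k, eval (linePoint (S := S) (p := p) (i₀ := i₀) a y) (rename Sum.inl (S.g k)) = 0) ∧
      (∀ k, eval (linePoint (S := S) (p := p) (i₀ := i₀) a y) (D.G k) = 0) ∧
      eval (linePoint (S := S) (p := p) (i₀ := i₀) a y) (rename Sum.inl S.h) *
        eval (linePoint (S := S) (p := p) (i₀ := i₀) a y) D.H ≠ 0 ∧
      eval (linePoint (S := S) (p := p) (i₀ := i₀) a y) (rename Sum.inl S.minor) *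
        eval (linePoint (S := S) (p := p) (i₀ := i₀) a y) D.jacobianDet ≠ 0 := by
    intro a
    rw [EtaleDatum.mem_image_iff]
    refine exists_congr fun y => ?_
    rw [hD'', jacobianDet_lineDatum (p := p) D hi₀]
    simp only [lineDatum, map_mul, eval_aeval_lineMap]
    constructor
    · rintro ⟨hGy, hHy, hJy⟩
      refine ⟨fun k => ?_, fun k => ?_, hHy, hJy⟩
      · have := hGy (Fin.castAdd r k); rwa [Fin.append_left, eval_aeval_lineMap] at this
      · have := hGy (Fin.natAdd c k); rwa [Fin.append_right, eval_aeval_lineMap] at this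
    · rintro ⟨hgy, hGy, hHy, hJy⟩
      refine ⟨fun k => ?_, hHy, hJy⟩
      refine Fin.addCases (fun k => ?_) (fun k => ?_) k
      · rw [Fin.append_left, eval_aeval_lineMap]; exact hgy k
      · rw [Fin.append_right, eval_aeval_lineMap]; exact hGy k
  -- the reconstructed point of `(0 ; (p ∘ cols, t₀))` is `(p, t₀)`
  have hpt0 : linePoint (S := S) (p := p) (i₀ := i₀) (fun _ => 0)
      (Fin.append (fun j => p (S.cols j)) t₀) = Sum.elim p t₀ := by
    ext s
    rcases s with i | k
    · simp only [linePoint, Sum.elim_inl, add_zero]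
      split_ifs with h1 h2
      · rw [h1]
      · rw [Fin.append_left, Classical.choose_spec h2]
      · rfl
    · simp [linePoint]
  have h0mem : (fun _ => (0 : K)) ∈ D''.image := by
    rw [hmem]
    refine ⟨Fin.append (fun j => p (S.cols j)) t₀, fun k => ?_, fun k => ?_, ?_, ?_⟩
    · rw [hpt0, EtaleDatum.eval_sumElim_rename_inl]; exact hg k
    · rw [hpt0]; exact hG k
    · rw [hpt0, EtaleDatum.eval_sumElim_rename_inl]; exact mul_ne_zero hh hH
    · rw [hpt0, EtaleDatum.eval_sumElim_rename_inl]; exact mul_ne_zero hΔ hJ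
  -- every point of the image is `0`
  have hsub : D''.image ⊆ {fun _ => 0} := by
    intro a ha
    rw [hmem] at ha
    obtain ⟨y, hgy, hGy, hHy, hJy⟩ := ha
    set x : Fin m → K := fun i => linePoint (S := S) (p := p) (i₀ := i₀) a y (Sum.inl i) with hx
    set t : Fin r → K := fun k => linePoint (S := S) (p := p) (i₀ := i₀) a y (Sum.inr k) with ht
    have hxt : linePoint (S := S) (p := p) (i₀ := i₀) a y = Sum.elim x t := by
      ext s; rcases s with i | k <;> rfl
    rw [hxt] at hgy hGy hHy hJy
    simp only [EtaleDatum.eval_sumElim_rename_inl] at hgy hHy hJy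
    have hxS : x ∈ S.locus := ⟨hgy, left_ne_zero_of_mul hHy, left_ne_zero_of_mul hJy⟩
    have hxD : x ∈ D.image := ⟨t, hGy, right_ne_zero_of_mul hHy, right_ne_zero_of_mul hJy⟩
    have hxp : x = p := hiso ⟨hxD, hxS⟩
    have ha0 : a 0 = 0 := by
      have h' := congrFun hxp i₀
      simp only [hx, linePoint, Sum.elim_inl, if_pos rfl] at h'
      exact add_eq_left.1 h'
    exact Set.mem_singleton_iff.2 (funext fun i => by rw [Fin.fin_one_eq_zero i, ha0])
  exact (hPAC _ D'' ⟨_, h0mem⟩) (Set.Finite.subset (Set.finite_singleton _) hsub)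

end Thm71

/-- **Étale images of the affine line over a pseudo-finite field are not discrete**: a nonempty
étale image `{a ∈ K | ∃ t, G(a,t) = 0, H(a,t)·det(∂G/∂t)(a,t) ≠ 0}` in `𝔸¹(K)`, `K`
pseudo-finite, is infinite.  (`EtaleDatum.image_infinite_of_nonempty_of_planeCurves` with the
plane-curve PAC property of pseudo-finite fields `planeCurve_infinite_of_nonsingular_psf`.)
This is the case `V = 𝔸¹` of [JohnsonTranWalsbergYe2024, Thm 7.1] for pseudo-finite fields.
[cite: JohnsonTranWalsbergYe2024, Thm 7.1] [cite: Ax1968, §§7–8] -/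
theorem EtaleDatum.image_infinite_of_nonempty_psf (K : Type) [Field K] [CompatibleRing K]
    [Infinite K] (hK : K ⊨ finiteFieldTheory) {r : ℕ} (D : EtaleDatum K 1 r)
    (hne : D.image.Nonempty) : D.image.Infinite :=
  D.image_infinite_of_nonempty_of_planeCurves
    (fun F Q a b _ h0 h1 h2 => planeCurve_infinite_of_nonsingular_psf K hK F Q a b h0 h1 h2) hne

/-- **Johnson–Tran–Walsberg–Ye 2024, Theorem 7.1, for pseudo-finite fields — discharge of the
named fact `JohnsonTranWalsbergYe2024_thm71_psf`.**  Over an infinite model `K` of the theory of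
finite fields, no point of a standard smooth locus `{g = 0, hΔ ≠ 0} ⊆ K^m` of codimension
`c < m` is isolated in the étale-open topology.  Printed proof: pseudo-finite fields are PAC
(Ax), hence large (Pop), and over a large field no smooth point of a positive-dimensional
variety is étale-isolated (JTWY Thm 7.1).  This formalisation: PAC for plane curves by transfer
of the Weil bound (`planeCurve_infinite_of_nonsingular_psf`), non-discreteness of étale images of
`𝔸¹` by the local structure of étale algebras (`EtaleDatum.image_infinite_of_nonempty_psf`), and
reduction of the general statement to the line through `p` along a free coordinate
(`Thm71.not_isEtaleIsolatedIn_of_lines`).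
[cite: JohnsonTranWalsbergYe2024, Thm 7.1 and Thm A] [cite: Pop1996, Prop. 1.1] [cite: Ax1968, §§7–8] -/
theorem JohnsonTranWalsbergYe2024_thm71_psf_holds : JohnsonTranWalsbergYe2024_thm71_psf := by
  intro K _ _ _ hK m c hcm S p hiso
  obtain ⟨hpS, r, D, hpD, hsub⟩ := hiso
  obtain ⟨i₀, hi₀⟩ := SmoothDatum.exists_free_coord hcm S
  exact Thm71.not_isEtaleIsolatedIn_of_lines D hi₀
    (fun r' D' hne => EtaleDatum.image_infinite_of_nonempty_psf K hK D' hne) hpS hpD hsub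

end Thm71

end Literature.ModelTheory.PseudofiniteFields
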